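import Literature.Computability.Complexity.StackNumeric
import Literature.Computability.Complexity.StackStreams
import Literature.Computability.Complexity.YatesMachineSetup
import Literature.Computability.Complexity.Williams2014PreprocSpec
import HarnessLib

/-!
# The preprocessing machine of Williams' Theorem 4.1, I: bank, routines, header, parameters

Literature / circuit complexity. In the proof of R. Williams, *Nonuniform ACC circuit lower
bounds*, J. ACM 61 (2014), Thm. 4.1, the input circuit `C` (on `n` inputs, over `accBasis m`)
is replaced by the OR `C'` of its `2^ℓ` restrictions to the first `ℓ` inputs
(`Circuit.orRestrictions`). The assembly `Williams2014_thm_4_1_of_machines`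
(`Williams2014AccSatAssembly.lean`) asks for a machine `P` printing `encodeAccCircuit m C'` from
`encodeAccCircuit m C` in time polynomial in `2^ℓ (n + size + fan-in + 2)` (hypothesis `hP`),
for a parameter `ℓ = ℓ(r, n)` within a constant factor of `n^{1/r}`. This series of files
CONSTRUCTS `P` as a structured stack program over the tree's numeric layer
(`StackNumeric.lean`: register type `EReg ⊕ β`, numerals, `nAdd`/`nSub`/`nCmp`/`nSucc`/`nMul`/
`nToUnary` between clean calculator states `base T`) with the item-stream routines of
`StackStreams.lean` / `StackWords.lean`, and proves its specification phase by phase against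
the closed form `orCodeList` of the target code (`Williams2014PreprocSpec.lean`,
`circuitCodeList_orRestrictions`). The parameter is `ℓ = ellOf r n = 2^{⌊log₂ n⌋ / r} - 1`
(so `ℓ ≤ n`, and `ℓ + 1 ≤ ⁿ√… `: the sandwich against `Nat.nthRoot r n` is proved with the
final assembly). This first file:

* generic routines: `Com.bitCount` (unary length of a register), `Com.popOne`, `Com.divProg`
  (unary division by a constant `r`: `takeRest`), `Com.emitReg` (emit a register as an item of
  the reversed output and count it);
* the own bank `POwn` (25 registers), its named file `PRF` with `simp` lemmas, the register
  type `PReg = EReg ⊕ POwn` (the numeric layer's calculator banks on the left);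
* the input format (`encodeAccCircuit_items`: unary length, `n`, the output wire's tag and
  index, `s`, then the gate items `gateItems`), numeral lemmas (`encodeNat_two_pow`,
  `encodeNat_two_pow_sub_one`, `length_encodeNat_sub_one = log₂`);
* **Phase 0** `headerProg` / `runs_headerProg` (read the header into `NN, TO, VO, SS`);
* **Phase 1** `paramsProg r` / `runs_paramsProg` (`q = ⌊log₂ n⌋ / r` in unary, `ℓ = 2^q - 1`
  in unary and binary, `2^ℓ` in unary and binary, `s + 2`, `G = 2^ℓ (s + 2)`, `n - ℓ`);
* **Phase 2** `emitHeaderProg` / `runs_emitHeaderProg` (emit `n - ℓ, 1, G, G + 1`).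

Specifications are frame-style over a named file `σ : PRF` (hypotheses on the registers used,
result as a structure update of `σ`), costs explicit.

## References

* R. Williams, *Nonuniform ACC circuit lower bounds*, J. ACM 61(1) (2014) 2:1–2:32, proof of
  Thm. 4.1 [Williams2014].
* S. Arora, B. Barak, *Computational Complexity: A Modern Approach*, CUP 2009, §0.1, §1.3
  [AroraBarak2009].
* T. Nipkow, G. Klein, *Concrete Semantics with Isabelle/HOL*, Springer 2014, §7.2 (the
  verification style).
-/

namespace Literature.Computability.Complexity

open SProg Com _root_.Computability GateList

namespace Com

variable {ι : Type} [DecidableEq ι]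

/-! ### Counting the bits of a register in unary (consuming it) -/

/-- `bitCount X U`: one token on `U` per bit of `X`, `X` emptied. [folklore] -/
def bitCount (X U : ι) : Com ι := loop X (push U true) (push U true)

/-- Effect of `bitCount`: `U := 1^{|X|} ++ U`, `X := []`, in `3 |X| + 1` steps. [folklore] -/
theorem runs_bitCount {X U : ι} (hXU : X ≠ U) :
    ∀ (v : List Bool) (R : Regs ι), R X = v →
      Runs (bitCount X U) R (Function.update (Function.update R X []) U (List.replicate v.length true ++ R U))
        (3 * v.length + 1)
  | [], R, hX => by
    refine (Runs.loop_nil _ _ hX).of_eq ?_ (by simp)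
    ext i : 1; simp only [Function.update_apply]; split_ifs <;> simp_all
  | b :: v, R, hX => by
    have hb : Runs (push U true) (Function.update R X v)
        (Function.update (Function.update R X v) U (true :: R U)) 1 :=
      Runs.push' (by ext i : 1; simp only [Function.update_apply]; split_ifs <;> simp_all)
    have ih := runs_bitCount hXU v (Function.update (Function.update R X v) U (true :: R U))
      (by simp only [Function.update_apply]; split_ifs <;> simp_all)
    have e : Function.update (Function.update (Function.update (Function.update R X v) U (true :: R U)) X [])
        U (List.replicate v.length true ++ Function.update (Function.update R X v) U (true :: R U) U) =
        Function.update (Function.update R X []) U (List.replicate (b :: v).length true ++ R U) := by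
      rw [List.length_cons, List.replicate_succ', List.append_assoc, List.singleton_append]
      ext i : 1; simp only [Function.update_apply]
      split_ifs <;> simp_all
    rw [e] at ih
    cases b
    · exact (Runs.loop_false hX hb ih).of_eq rfl (by simp; omega)
    · exact (Runs.loop_true hX hb ih).of_eq rfl (by simp; omega)

/-! ### Removing one token -/

/-- `popOne U`: remove the top bit of `U` if any. [folklore] -/
def popOne (U : ι) : Com ι := pop U skip skip skip

/-- Effect of `popOne` on a unary counter: `1ᵏ ↦ 1^{k-1}`, in `2` steps. [folklore] -/
theorem runs_popOne (U : ι) (k : ℕ) (R : Regs ι) (hU : R U = List.replicate k true) :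
    Runs (popOne U) R (Function.update R U (List.replicate (k - 1) true)) 2 := by
  cases k with
  | zero =>
    refine (Runs.pop_nil _ _ hU (Runs.skip R)).of_eq ?_ (by norm_num)
    rw [List.replicate_zero] at hU
    rw [Nat.zero_sub, List.replicate_zero, ← hU, Function.update_eq_self]
  | succ k =>
    rw [List.replicate_succ] at hU
    exact (Runs.pop_true _ _ hU (Runs.skip _)).of_eq (by simp) (by norm_num)

/-! ### Division of a unary counter by a constant -/

/-- `takeRest U Q j`: try to remove `j` further tokens from `U`; on success put one token on
`Q`. [folklore] -/
def takeRest (U Q : ι) : ℕ → Com ι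
  | 0 => push Q true
  | j + 1 => pop U (takeRest U Q j) (takeRest U Q j) skip

/-- Effect of `takeRest` on `U = 1ᵘ`: if `j ≤ u`, `U := 1^{u-j}` and a token goes to `Q`;
otherwise `U` is emptied and `Q` is unchanged; within `2 j + 1` steps. [folklore] -/
theorem runs_takeRest {U Q : ι} (hUQ : U ≠ Q) :
    ∀ (j u : ℕ) (R : Regs ι), R U = List.replicate u true →
      Runs (takeRest U Q j) R
        (if j ≤ u then Function.update (Function.update R U (List.replicate (u - j) true)) Q (true :: R Q)
          else Function.update R U []) (2 * j + 1)
  | 0, u, R, hU => by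
    refine (Runs.push Q true R).of_eq ?_ (by simp)
    rw [if_pos (Nat.zero_le _), Nat.sub_zero, ← hU, Function.update_eq_self]
  | j + 1, 0, R, hU => by
    rw [List.replicate_zero] at hU
    refine (Runs.pop_nil _ _ hU (Runs.skip R)).of_eq ?_ (by omega)
    rw [if_neg (by omega), ← hU, Function.update_eq_self]
  | j + 1, u + 1, R, hU => by
    rw [List.replicate_succ] at hU
    have ih := runs_takeRest hUQ j u (Function.update R U (List.replicate u true)) (by simp)
    refine (Runs.pop_true _ _ hU ih).of_eq ?_ (by omega)
    by_cases h : j ≤ u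
    · rw [if_pos h, if_pos (by omega), Nat.succ_sub_succ]
      ext i : 1; simp only [Function.update_apply]; split_ifs <;> simp_all
    · rw [if_neg h, if_neg (by omega)]
      ext i : 1; simp only [Function.update_apply]; split_ifs <;> simp_all

/-- `divProg U Q r`: `Q := 1^{⌊|U| / r⌋} ++ Q`, consuming the unary counter `U` (`r ≥ 1`).
[folklore] -/
def divProg (U Q : ι) (r : ℕ) : Com ι := loop U (takeRest U Q (r - 1)) (takeRest U Q (r - 1))

/-- **Effect of `divProg`**: from `U = 1ᵘ`, `U` is emptied and `⌊u / r⌋` tokens are put on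
`Q`, within `u (2 r + 1) + 1` steps. [folklore] -/
theorem runs_divProg {U Q : ι} (hUQ : U ≠ Q) {r : ℕ} (hr : 0 < r) :
    ∀ (u : ℕ) (R : Regs ι), R U = List.replicate u true →
      Runs (divProg U Q r) R (Function.update (Function.update R U []) Q (List.replicate (u / r) true ++ R Q))
        (u * (2 * r + 1) + 1) := by
  intro u
  induction u using Nat.strong_induction_on with
  | _ u ih =>
    intro R hU
    cases u with
    | zero =>
      refine (Runs.loop_nil _ _ hU).of_eq ?_ (by simp)
      rw [Nat.zero_div, List.replicate_zero, List.nil_append]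
      ext i : 1; simp only [Function.update_apply]; split_ifs <;> simp_all
    | succ u =>
      rw [List.replicate_succ] at hU
      have hb := runs_takeRest hUQ (r - 1) u (Function.update R U (List.replicate u true)) (by simp)
      by_cases h : r - 1 ≤ u
      · rw [if_pos h] at hb
        have ih' := ih (u - (r - 1)) (by omega) (Function.update (Function.update (Function.update R U
          (List.replicate u true)) U (List.replicate (u - (r - 1)) true)) Q
          (true :: Function.update R U (List.replicate u true) Q)) (by
            rw [Function.update_of_ne hUQ, Function.update_self])
        refine (Runs.loop_true hU hb ih').of_eq ?_ ?_
        · have hq : (u + 1) / r = (u - (r - 1)) / r + 1 := by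
            have : u + 1 = (u - (r - 1)) + r := by omega
            rw [this, Nat.add_div_right _ hr]
          rw [hq, List.replicate_succ', List.append_assoc, List.singleton_append]
          ext i : 1; simp only [Function.update_apply]; split_ifs <;> simp_all
        · have : (u - (r - 1)) * (2 * r + 1) + r * (2 * r + 1) ≤ (u + 1) * (2 * r + 1) := by
            rw [← Nat.add_mul]; exact Nat.mul_le_mul_right _ (by omega)
          have : 2 * (r - 1) + 3 ≤ r * (2 * r + 1) := by
            have : 2 * (r - 1) + 3 ≤ 2 * r + 1 := by omega
            exact this.trans (Nat.le_mul_of_pos_left _ hr)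
          omega
      · rw [if_neg h] at hb
        have hfin : Runs (loop U (takeRest U Q (r - 1)) (takeRest U Q (r - 1)))
            (Function.update (Function.update R U (List.replicate u true)) U []) _ 1 :=
          Runs.loop_nil _ _ (by simp)
        refine (Runs.loop_true hU hb hfin).of_eq ?_ ?_
        · have hq : (u + 1) / r = 0 := Nat.div_eq_of_lt (by omega)
          rw [hq, List.replicate_zero, List.nil_append]
          ext i : 1; simp only [Function.update_apply]; split_ifs <;> simp_all
        · have : 2 * (r - 1) + 1 + 2 + 1 ≤ 1 * (2 * r + 1) + 1 := by omega
          exact this.trans (by nlinarith)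

/-! ### Emitting the contents of a register as an item, counting items -/

/-- `emitReg X o cnt`: append the item `X` to the reversed output `o` (`emitPart`, `emitSep`),
count it on `cnt`; `X` is emptied. [folklore] -/
def emitReg (X o cnt : ι) : Com ι := emitPart X o ;; (emitSep o ;; push cnt true)

/-- **Effect of `emitReg`** on a reversed output `outRev E`: `o := outRev (E ++ [X])`,
`cnt := 1 :: cnt`, `X := []`, in `4 |X| + 4` steps. [folklore] -/
theorem runs_emitReg {X o cnt : ι} (hXo : X ≠ o) (hXc : X ≠ cnt) (hoc : o ≠ cnt) (E : List (List Bool))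
    (v : List Bool) (R : Regs ι) (hX : R X = v) (ho : R o = outRev E) :
    Runs (emitReg X o cnt) R
      (Function.update (Function.update (Function.update R X []) o (outRev (E ++ [v]))) cnt (true :: R cnt))
      (4 * v.length + 4) := by
  have h1 := runs_emitPart hXo R
  have h2 := runs_emitSep o (Function.update (Function.update R X []) o ((dbl (R X)).reverse ++ R o))
  have h3 := Runs.push cnt true (Function.update (Function.update (Function.update R X []) o
    ((dbl (R X)).reverse ++ R o)) o (true :: false :: Function.update (Function.update R X []) o
    ((dbl (R X)).reverse ++ R o) o))
  refine (h1.seq (h2.seq h3)).of_eq ?_ (by rw [hX])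
  rw [outRev_append_eq, hX, ho]
  ext i : 1; simp only [Function.update_apply]; split_ifs <;> simp_all

end Com

/-! ### The own bank of the preprocessing machine -/

/-- The own registers of the preprocessing machine. [folklore] -/
inductive POwn
  | inp | out | o | w | tk | cnt | NN | TO | VO | SS | Ku | Vu | EL | Eu | Lu | LN | G | A | AW | GW | T | V | X | F | U2
  deriving DecidableEq, Fintype, Repr

/-- The own register file of the preprocessing machine by name. [folklore] -/
structure PRF where
  /-- the input code -/ (inp : List Bool)
  /-- the output register -/ (out : List Bool)
  /-- reversed output accumulator -/ (o : List Bool)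
  /-- token register of the readers -/ (w : List Bool)
  /-- reader scratch / token sink / doubling scratch -/ (tk : List Bool)
  /-- unary count of the emitted items -/ (cnt : List Bool)
  /-- numeral `n`, later `n - ℓ` -/ (NN : List Bool)
  /-- numeral: tag of the output wire -/ (TO : List Bool)
  /-- numeral: index of the output wire -/ (VO : List Bool)
  /-- numeral `s`, later `s + 2` -/ (SS : List Bool)
  /-- unary: bit count of `n`, later arities -/ (Ku : List Bool)
  /-- unary: `q`, later wire indices -/ (Vu : List Bool)
  /-- numeral `ℓ` -/ (EL : List Bool)
  /-- unary `ℓ` -/ (Eu : List Bool)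
  /-- unary `2^ℓ` (copy counter) -/ (Lu : List Bool)
  /-- numeral `2^ℓ` -/ (LN : List Bool)
  /-- numeral `G = 2^ℓ (s+2)` -/ (G : List Bool)
  /-- numeral: offset of the current copy -/ (A : List Bool)
  /-- the `ℓ`-bit word of the current copy index -/ (AW : List Bool)
  /-- work copy of the gate items -/ (GW : List Bool)
  /-- numeral: tag of the current wire -/ (T : List Bool)
  /-- numeral: index of the current wire -/ (V : List Bool)
  /-- scratch numeral / word -/ (X : List Bool)
  /-- comparison flag -/ (F : List Bool)
  /-- unary loop counter scratch -/ (U2 : List Bool)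

namespace PRF

/-- The own register file as a function. [folklore] -/
def regs (σ : PRF) : Regs POwn
  | .inp => σ.inp | .out => σ.out | .o => σ.o | .w => σ.w | .tk => σ.tk | .cnt => σ.cnt | .NN => σ.NN | .TO => σ.TO | .VO => σ.VO | .SS => σ.SS | .Ku => σ.Ku | .Vu => σ.Vu | .EL => σ.EL | .Eu => σ.Eu | .Lu => σ.Lu | .LN => σ.LN | .G => σ.G | .A => σ.A | .AW => σ.AW | .GW => σ.GW | .T => σ.T | .V => σ.V | .X => σ.X | .F => σ.F | .U2 => σ.U2

/-- The all-empty own file. [folklore] -/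
@[simps] def empty : PRF := ⟨[], [], [], [], [], [], [], [], [], [], [], [], [], [], [], [], [], [], [], [], [], [], [], [], []⟩

section Simp

variable (σ : PRF) (v : List Bool)

/-- reading `inp` [folklore] -/ @[simp] theorem regs_inp : regs σ .inp = σ.inp := rfl
/-- reading `out` [folklore] -/ @[simp] theorem regs_out : regs σ .out = σ.out := rfl
/-- reading `o` [folklore] -/ @[simp] theorem regs_o : regs σ .o = σ.o := rfl
/-- reading `w` [folklore] -/ @[simp] theorem regs_w : regs σ .w = σ.w := rfl
/-- reading `tk` [folklore] -/ @[simp] theorem regs_tk : regs σ .tk = σ.tk := rfl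
/-- reading `cnt` [folklore] -/ @[simp] theorem regs_cnt : regs σ .cnt = σ.cnt := rfl
/-- reading `NN` [folklore] -/ @[simp] theorem regs_NN : regs σ .NN = σ.NN := rfl
/-- reading `TO` [folklore] -/ @[simp] theorem regs_TO : regs σ .TO = σ.TO := rfl
/-- reading `VO` [folklore] -/ @[simp] theorem regs_VO : regs σ .VO = σ.VO := rfl
/-- reading `SS` [folklore] -/ @[simp] theorem regs_SS : regs σ .SS = σ.SS := rfl
/-- reading `Ku` [folklore] -/ @[simp] theorem regs_Ku : regs σ .Ku = σ.Ku := rfl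
/-- reading `Vu` [folklore] -/ @[simp] theorem regs_Vu : regs σ .Vu = σ.Vu := rfl
/-- reading `EL` [folklore] -/ @[simp] theorem regs_EL : regs σ .EL = σ.EL := rfl
/-- reading `Eu` [folklore] -/ @[simp] theorem regs_Eu : regs σ .Eu = σ.Eu := rfl
/-- reading `Lu` [folklore] -/ @[simp] theorem regs_Lu : regs σ .Lu = σ.Lu := rfl
/-- reading `LN` [folklore] -/ @[simp] theorem regs_LN : regs σ .LN = σ.LN := rfl
/-- reading `G` [folklore] -/ @[simp] theorem regs_G : regs σ .G = σ.G := rfl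
/-- reading `A` [folklore] -/ @[simp] theorem regs_A : regs σ .A = σ.A := rfl
/-- reading `AW` [folklore] -/ @[simp] theorem regs_AW : regs σ .AW = σ.AW := rfl
/-- reading `GW` [folklore] -/ @[simp] theorem regs_GW : regs σ .GW = σ.GW := rfl
/-- reading `T` [folklore] -/ @[simp] theorem regs_T : regs σ .T = σ.T := rfl
/-- reading `V` [folklore] -/ @[simp] theorem regs_V : regs σ .V = σ.V := rfl
/-- reading `X` [folklore] -/ @[simp] theorem regs_X : regs σ .X = σ.X := rfl
/-- reading `F` [folklore] -/ @[simp] theorem regs_F : regs σ .F = σ.F := rfl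
/-- reading `U2` [folklore] -/ @[simp] theorem regs_U2 : regs σ .U2 = σ.U2 := rfl

/-- updating `inp` [folklore] -/
@[simp] theorem update_inp : Function.update (regs σ) .inp v = regs { σ with inp := v } := by
  funext i; cases i <;> rfl
/-- updating `out` [folklore] -/
@[simp] theorem update_out : Function.update (regs σ) .out v = regs { σ with out := v } := by
  funext i; cases i <;> rfl
/-- updating `o` [folklore] -/
@[simp] theorem update_o : Function.update (regs σ) .o v = regs { σ with o := v } := by
  funext i; cases i <;> rfl
/-- updating `w` [folklore] -/
@[simp] theorem update_w : Function.update (regs σ) .w v = regs { σ with w := v } := by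
  funext i; cases i <;> rfl
/-- updating `tk` [folklore] -/
@[simp] theorem update_tk : Function.update (regs σ) .tk v = regs { σ with tk := v } := by
  funext i; cases i <;> rfl
/-- updating `cnt` [folklore] -/
@[simp] theorem update_cnt : Function.update (regs σ) .cnt v = regs { σ with cnt := v } := by
  funext i; cases i <;> rfl
/-- updating `NN` [folklore] -/
@[simp] theorem update_NN : Function.update (regs σ) .NN v = regs { σ with NN := v } := by
  funext i; cases i <;> rfl
/-- updating `TO` [folklore] -/
@[simp] theorem update_TO : Function.update (regs σ) .TO v = regs { σ with TO := v } := by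
  funext i; cases i <;> rfl
/-- updating `VO` [folklore] -/
@[simp] theorem update_VO : Function.update (regs σ) .VO v = regs { σ with VO := v } := by
  funext i; cases i <;> rfl
/-- updating `SS` [folklore] -/
@[simp] theorem update_SS : Function.update (regs σ) .SS v = regs { σ with SS := v } := by
  funext i; cases i <;> rfl
/-- updating `Ku` [folklore] -/
@[simp] theorem update_Ku : Function.update (regs σ) .Ku v = regs { σ with Ku := v } := by
  funext i; cases i <;> rfl
/-- updating `Vu` [folklore] -/
@[simp] theorem update_Vu : Function.update (regs σ) .Vu v = regs { σ with Vu := v } := by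
  funext i; cases i <;> rfl
/-- updating `EL` [folklore] -/
@[simp] theorem update_EL : Function.update (regs σ) .EL v = regs { σ with EL := v } := by
  funext i; cases i <;> rfl
/-- updating `Eu` [folklore] -/
@[simp] theorem update_Eu : Function.update (regs σ) .Eu v = regs { σ with Eu := v } := by
  funext i; cases i <;> rfl
/-- updating `Lu` [folklore] -/
@[simp] theorem update_Lu : Function.update (regs σ) .Lu v = regs { σ with Lu := v } := by
  funext i; cases i <;> rfl
/-- updating `LN` [folklore] -/
@[simp] theorem update_LN : Function.update (regs σ) .LN v = regs { σ with LN := v } := by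
  funext i; cases i <;> rfl
/-- updating `G` [folklore] -/
@[simp] theorem update_G : Function.update (regs σ) .G v = regs { σ with G := v } := by
  funext i; cases i <;> rfl
/-- updating `A` [folklore] -/
@[simp] theorem update_A : Function.update (regs σ) .A v = regs { σ with A := v } := by
  funext i; cases i <;> rfl
/-- updating `AW` [folklore] -/
@[simp] theorem update_AW : Function.update (regs σ) .AW v = regs { σ with AW := v } := by
  funext i; cases i <;> rfl
/-- updating `GW` [folklore] -/
@[simp] theorem update_GW : Function.update (regs σ) .GW v = regs { σ with GW := v } := by
  funext i; cases i <;> rfl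
/-- updating `T` [folklore] -/
@[simp] theorem update_T : Function.update (regs σ) .T v = regs { σ with T := v } := by
  funext i; cases i <;> rfl
/-- updating `V` [folklore] -/
@[simp] theorem update_V : Function.update (regs σ) .V v = regs { σ with V := v } := by
  funext i; cases i <;> rfl
/-- updating `X` [folklore] -/
@[simp] theorem update_X : Function.update (regs σ) .X v = regs { σ with X := v } := by
  funext i; cases i <;> rfl
/-- updating `F` [folklore] -/
@[simp] theorem update_F : Function.update (regs σ) .F v = regs { σ with F := v } := by
  funext i; cases i <;> rfl
/-- updating `U2` [folklore] -/
@[simp] theorem update_U2 : Function.update (regs σ) .U2 v = regs { σ with U2 := v } := by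
  funext i; cases i <;> rfl

/-- The empty file is empty. [folklore] -/
@[simp] theorem regs_empty (r : POwn) : regs empty r = [] := by cases r <;> rfl

end Simp

end PRF

/-! ### The register type: the numeric layer's calculator on the left, the own bank on the right -/

/-- The registers of the preprocessing machine. [folklore] -/
abbrev PReg := EReg ⊕ POwn

namespace PreprocP

open PRF

/-! ### Register names -/

/-- own register `inp` -/ abbrev pinp : PReg := Sum.inr POwn.inp
/-- own register `out` -/ abbrev pout : PReg := Sum.inr POwn.out
/-- own register `o` -/ abbrev po : PReg := Sum.inr POwn.o
/-- own register `w` -/ abbrev pw : PReg := Sum.inr POwn.w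
/-- own register `tk` -/ abbrev ptk : PReg := Sum.inr POwn.tk
/-- own register `cnt` -/ abbrev pcnt : PReg := Sum.inr POwn.cnt
/-- own register `NN` -/ abbrev pNN : PReg := Sum.inr POwn.NN
/-- own register `TO` -/ abbrev pTO : PReg := Sum.inr POwn.TO
/-- own register `VO` -/ abbrev pVO : PReg := Sum.inr POwn.VO
/-- own register `SS` -/ abbrev pSS : PReg := Sum.inr POwn.SS
/-- own register `Ku` -/ abbrev pKu : PReg := Sum.inr POwn.Ku
/-- own register `Vu` -/ abbrev pVu : PReg := Sum.inr POwn.Vu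
/-- own register `EL` -/ abbrev pEL : PReg := Sum.inr POwn.EL
/-- own register `Eu` -/ abbrev pEu : PReg := Sum.inr POwn.Eu
/-- own register `Lu` -/ abbrev pLu : PReg := Sum.inr POwn.Lu
/-- own register `LN` -/ abbrev pLN : PReg := Sum.inr POwn.LN
/-- own register `G` -/ abbrev pG : PReg := Sum.inr POwn.G
/-- own register `A` -/ abbrev pA : PReg := Sum.inr POwn.A
/-- own register `AW` -/ abbrev pAW : PReg := Sum.inr POwn.AW
/-- own register `GW` -/ abbrev pGW : PReg := Sum.inr POwn.GW
/-- own register `T` -/ abbrev pT : PReg := Sum.inr POwn.T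
/-- own register `V` -/ abbrev pV : PReg := Sum.inr POwn.V
/-- own register `X` -/ abbrev pX : PReg := Sum.inr POwn.X
/-- own register `F` -/ abbrev pF : PReg := Sum.inr POwn.F
/-- own register `U2` -/ abbrev pU2 : PReg := Sum.inr POwn.U2


/-! ### Reading and updating the file `base σ.regs` -/

section Simp

variable (σ : PRF) (r : POwn) (v : List Bool)

/-- Reading an own register of `base σ.regs`. [folklore] -/
@[simp] theorem base_inr : base σ.regs (Sum.inr r) = σ.regs r := rfl

end Simp

/-! ### The input format -/

variable {n : ℕ}

/-- The tag of a wire code: `0` for an input, `1` for a gate. [folklore] -/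
def wtag : Fin n ⊕ ℕ → ℕ
  | Sum.inl _ => 0
  | Sum.inr _ => 1

/-- The index of a wire code. [folklore] -/
def wval : Fin n ⊕ ℕ → ℕ
  | Sum.inl i => i
  | Sum.inr j => j

/-- A wire code is its tag and its index. [folklore] -/
theorem wireCode_eq (w : Fin n ⊕ ℕ) : wireCode w = [wtag w, wval w] := by
  cases w <;> rfl

/-- The items of the gates of `C`: for each gate its code, arity and wire codes, as numerals.
[folklore] -/
def gateItems (m : ℕ) (C : Circuit (Fin n)) : List (List Bool) :=
  (C.gates.flatMap (gateCodeList m)).map encodeNat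

/-- **The input as read by the machine**: the unary length item, the numerals of `n`, of the
output wire's tag and index, of `s`, then the gate items. [folklore] -/
theorem encodeAccCircuit_items (m : ℕ) (C : Circuit (Fin n)) :
    encodeAccCircuit m C = encList (unaryEncodeNat (circuitCodeList m C).length :: encodeNat n ::
      encodeNat (wtag C.output) :: encodeNat (wval C.output) :: encodeNat C.size :: gateItems m C) := by
  rw [encodeAccCircuit, encodingListNatBool_encode_eq_encList, circuitCodeList, wireCode_eq]
  rfl

/-! ### Numerals of special values -/

/-- `1ᵠ` is the numeral of `2^q - 1`. [folklore] -/
theorem bitsToNat_replicate_true (q : ℕ) : bitsToNat (List.replicate q true) = 2 ^ q - 1 := by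
  induction q with
  | zero => rfl
  | succ q ih =>
    rw [List.replicate_succ, bitsToNat_cons, ih, Bool.toNat_true, Nat.pow_succ]
    have := Nat.one_le_two_pow (n := q)
    omega

/-- The numeral of `2^q - 1` is `1ᵠ`. [folklore] -/
theorem encodeNat_two_pow_sub_one (q : ℕ) : encodeNat (2 ^ q - 1) = List.replicate q true := by
  refine (eq_of_bitsToNat_eq_of_canonical _ _ (encodeNat_canonical _) ?_ ?_)
  · cases q with
    | zero => exact Or.inl rfl
    | succ q => exact Or.inr ⟨List.replicate q true, by rw [List.replicate_succ']⟩
  · rw [bitsToNat_encodeNat, bitsToNat_replicate_true]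

/-- The numeral of `2^q` is `0ᵠ1`. [folklore] -/
theorem encodeNat_two_pow (q : ℕ) : encodeNat (2 ^ q) = List.replicate q false ++ [true] := by
  refine (eq_of_bitsToNat_eq_of_canonical _ _ (encodeNat_canonical _) (Or.inr ⟨_, rfl⟩) ?_)
  rw [bitsToNat_encodeNat, bitsToNat_append, bitsToNat_replicate_false, List.length_replicate]
  simp

/-- The numeral of `1`. [folklore] -/
theorem encodeNat_one : encodeNat 1 = [true] := by decide

/-- The numeral of `2`. [folklore] -/
theorem encodeNat_two : encodeNat 2 = [false, true] := by decide

/-- The numeral of `0`. [folklore] -/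
theorem encodeNat_zero : encodeNat 0 = [] := by decide

/-- The number of bits of the numeral of `n`, less one, is `⌊log₂ n⌋` (both `0` at `n = 0`).
[folklore] -/
theorem length_encodeNat_sub_one (n : ℕ) : (encodeNat n).length - 1 = Nat.log 2 n := by
  rw [TM2Pass.length_encodeNat_eq_size]
  rcases Nat.eq_zero_or_pos n with rfl | hn
  · simp
  · have h1 : Nat.log 2 n < Nat.size n := Nat.lt_size.2 (Nat.pow_log_le_self 2 hn.ne')
    have h2 : Nat.size n ≤ Nat.log 2 n + 1 := Nat.size_le.2 (Nat.lt_pow_succ_log_self one_lt_two n)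
    omega

/-- **The parameter of the preprocessing**: `ℓ = 2^{⌊log₂ n⌋ / r} - 1` (within a factor `2` of
`n^{1/r}`; the machine computes it from the bit count of `n`). [cite: Williams2014, Thm. 4.1] -/
def ellOf (r n : ℕ) : ℕ := 2 ^ (Nat.log 2 n / r) - 1

/-- `ℓ ≤ n`. [folklore] -/
theorem ellOf_le (r n : ℕ) : ellOf r n ≤ n := by
  unfold ellOf
  rcases Nat.eq_zero_or_pos n with rfl | hn
  · simp
  · have h1 : 2 ^ (Nat.log 2 n / r) ≤ 2 ^ Nat.log 2 n := Nat.pow_le_pow_right two_pos (Nat.div_le_self _ _)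
    have h2 := Nat.pow_log_le_self 2 hn.ne'
    omega

/-! ### Phase 0: the header -/

/-- `headerProg`: drop the length item; read `n`, the output wire (tag, index) and `s` into
`NN, TO, VO, SS`. [folklore] -/
def headerProg : Com PReg :=
  skipItem pinp pw ptk ;; (readItemTo pinp pNN pw ptk ;; (readItemTo pinp pTO pw ptk ;;
    (readItemTo pinp pVO pw ptk ;; readItemTo pinp pSS pw ptk)))

/-- The cost of the header phase. [folklore] -/
def headerCost (len a b c d : ℕ) : ℕ :=
  10 * len + 9 + (11 * a + 9) + (11 * b + 9) + (11 * c + 9) + (11 * d + 9)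

/-- **Effect of the header phase**: the gate items stay on `inp`; `NN = bin n`, `TO, VO` = the
output wire, `SS = bin s`. [folklore] -/
theorem runs_headerProg (m : ℕ) (C : Circuit (Fin n)) (σ : PRF) (hinp : σ.inp = encodeAccCircuit m C)
    (hw : σ.w = []) (htk : σ.tk = []) (hNN : σ.NN = []) (hTO : σ.TO = []) (hVO : σ.VO = [])
    (hSS : σ.SS = []) :
    Runs headerProg (base σ.regs)
      (base { σ with
        inp := encList (gateItems m C), NN := encodeNat n, TO := encodeNat (wtag C.output)
        VO := encodeNat (wval C.output), SS := encodeNat C.size }.regs)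
      (headerCost (circuitCodeList m C).length (encodeNat n).length (encodeNat (wtag C.output)).length
        (encodeNat (wval C.output)).length (encodeNat C.size).length) := by
  rw [encodeAccCircuit_items] at hinp
  set I4 := encList (gateItems m C) with hI4
  set I3 := encList (encodeNat C.size :: gateItems m C) with hI3
  set I2 := encList (encodeNat (wval C.output) :: encodeNat C.size :: gateItems m C) with hI2
  set I1 := encList (encodeNat (wtag C.output) :: encodeNat (wval C.output) :: encodeNat C.size ::
    gateItems m C) with hI1
  set I0 := encList (encodeNat n :: encodeNat (wtag C.output) :: encodeNat (wval C.output) ::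
    encodeNat C.size :: gateItems m C) with hI0
  set σ₀ : PRF := { σ with inp := I0 } with hσ₀
  have h0 : Runs (skipItem pinp pw ptk) (base σ.regs) (base σ₀.regs) (10 * (circuitCodeList m C).length + 9) := by
    have h := runs_skipItem (L := pinp) (w := pw) (t := ptk) (by decide) (by decide) (by decide)
      (unaryEncodeNat (circuitCodeList m C).length) I0 (base σ.regs)
      (by simp [hinp, hI0, encList_cons_eq_dbl]) (by simp [hw]) (by simp [htk])
    refine h.of_eq ?_ (by simp [YatesM.length_unaryEncodeNat])
    simp only [hσ₀]; simp
  set σ₁ : PRF := { σ with inp := I1, NN := encodeNat n } with hσ₁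
  have h1 : Runs (readItemTo pinp pNN pw ptk) (base σ₀.regs) (base σ₁.regs) (11 * (encodeNat n).length + 9) := by
    have h := runs_readItemTo (L := pinp) (A := pNN) (w := pw) (t := ptk) (by decide) (by decide)
      (by decide) (by decide) (by decide) (encodeNat n) I1 (base σ₀.regs)
      (by simp [hσ₀, hI0, hI1, encList_cons_eq_dbl]) (by simp [hσ₀, hw]) (by simp [hσ₀, htk])
    refine h.of_eq ?_ le_rfl
    simp only [hσ₁, hσ₀]; simp [hNN]
  set σ₂ : PRF := { σ with inp := I2, NN := encodeNat n, TO := encodeNat (wtag C.output) } with hσ₂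
  have h2 : Runs (readItemTo pinp pTO pw ptk) (base σ₁.regs) (base σ₂.regs)
      (11 * (encodeNat (wtag C.output)).length + 9) := by
    have h := runs_readItemTo (L := pinp) (A := pTO) (w := pw) (t := ptk) (by decide) (by decide)
      (by decide) (by decide) (by decide) (encodeNat (wtag C.output)) I2 (base σ₁.regs)
      (by simp [hσ₁, hI1, hI2, encList_cons_eq_dbl]) (by simp [hσ₁, hw]) (by simp [hσ₁, htk])
    refine h.of_eq ?_ le_rfl
    simp only [hσ₂, hσ₁]; simp [hTO]
  set σ₃ : PRF := { σ with
    inp := I3, NN := encodeNat n, TO := encodeNat (wtag C.output)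
    VO := encodeNat (wval C.output) } with hσ₃
  have h3 : Runs (readItemTo pinp pVO pw ptk) (base σ₂.regs) (base σ₃.regs)
      (11 * (encodeNat (wval C.output)).length + 9) := by
    have h := runs_readItemTo (L := pinp) (A := pVO) (w := pw) (t := ptk) (by decide) (by decide)
      (by decide) (by decide) (by decide) (encodeNat (wval C.output)) I3 (base σ₂.regs)
      (by simp [hσ₂, hI2, hI3, encList_cons_eq_dbl]) (by simp [hσ₂, hw]) (by simp [hσ₂, htk])
    refine h.of_eq ?_ le_rfl
    simp only [hσ₃, hσ₂]; simp [hVO]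
  set σ₄ : PRF := { σ with
    inp := I4, NN := encodeNat n, TO := encodeNat (wtag C.output)
    VO := encodeNat (wval C.output), SS := encodeNat C.size } with hσ₄
  have h4 : Runs (readItemTo pinp pSS pw ptk) (base σ₃.regs) (base σ₄.regs)
      (11 * (encodeNat C.size).length + 9) := by
    have h := runs_readItemTo (L := pinp) (A := pSS) (w := pw) (t := ptk) (by decide) (by decide)
      (by decide) (by decide) (by decide) (encodeNat C.size) I4 (base σ₃.regs)
      (by simp [hσ₃, hI3, hI4, encList_cons_eq_dbl]) (by simp [hσ₃, hw]) (by simp [hσ₃, htk])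
    refine h.of_eq ?_ le_rfl
    simp only [hσ₄, hσ₃]; simp [hSS]
  refine (h0.seq (h1.seq (h2.seq (h3.seq h4)))).of_eq (by simp only [hσ₄]) ?_
  unfold headerCost; omega


/-! ### Phase 1: the parameters `q`, `ℓ`, `2^ℓ`, `s + 2`, `G`, `n - ℓ` -/

/-- One doubling of the unary `ℓ`-counter together with one more `1` on the numeral of `ℓ`.
[folklore] -/
def dblBody : Com PReg := dblUnary pEu ptk ;; push pEL true

/-- `mkLu`: `Lu := 1^{2^ℓ}` by `ℓ` doublings of a single token (`U2` a copy of the unary `ℓ`).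
[folklore] -/
def mkLu : Com PReg := push pLu true ;; (copy pEu pU2 (ra .t) (ra .u) ;; countLoop pU2 (dblUnary pLu ptk))

/-- `mkLN`: `LN := 0^ℓ 1`, the numeral of `2^ℓ`. [folklore] -/
def mkLN : Com PReg := push pLN true ;; (copy pEu pU2 (ra .t) (ra .u) ;; countLoop pU2 (push pLN false))

/-- `paramsProg r`: `q = ⌊log₂ n⌋ / r` in unary (bit count of `bin n` less one, divided by
`r`), `ℓ = 2^q - 1` in unary (`Eu`) and binary (`EL = 1^q`), `2^ℓ` in unary (`Lu`) and binary
(`LN`), then `SS := bin (s + 2)`, `G := bin (2^ℓ (s + 2))`, `NN := bin (n - ℓ)`. [folklore] -/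
def paramsProg (r : ℕ) : Com PReg :=
  (copy pNN pX (ra .t) (ra .u) ;; (bitCount pX pKu ;; (popOne pKu ;; divProg pKu pVu r))) ;;
  ((push pEu true ;; (countLoop pVu dblBody ;; popOne pEu)) ;;
  (mkLu ;; (mkLN ;;
  (nSucc .SS .SS ;; (nSucc .SS .SS ;; (nMul .G .LN .SS ;; nSub .NN .NN .EL))))))

/-- The cost of the parameter phase (`q = ⌊log₂ n⌋ / r`, `ℓ = 2^q - 1`). [folklore] -/
def paramsCost (r n s q ℓ : ℕ) : ℕ :=
  (10 * (encodeNat n).length + 3) + (3 * (encodeNat n).length + 1) + 2 +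
    (Nat.log 2 n * (2 * r + 1) + 1) +
  (1 + (q * (7 * 2 ^ q + 3 + 2) + 1) + 2) +
  (1 + (10 * ℓ + 3) + (ℓ * (7 * 2 ^ ℓ + 2 + 2) + 1)) +
  (1 + (10 * ℓ + 3) + (ℓ * (1 + 2) + 1)) +
  (72 * (s + 1) + 72 * (s + 2) + 270 * (ℓ + s + 3) ^ 2 + 71 * (n + 1))

/-- Effect of `mkLu`. [folklore] -/
theorem runs_mkLu (ℓ : ℕ) (σ : PRF) (hEu : σ.Eu = List.replicate ℓ true) (hLu : σ.Lu = [])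
    (hU2 : σ.U2 = []) (htk : σ.tk = []) :
    Runs mkLu (base σ.regs) (base { σ with Lu := List.replicate (2 ^ ℓ) true }.regs)
      (1 + (10 * ℓ + 3) + (ℓ * (7 * 2 ^ ℓ + 2 + 2) + 1)) := by
  set σ₁ : PRF := { σ with Lu := [true] } with hσ₁
  have h1 : Runs (push pLu true) (base σ.regs) (base σ₁.regs) 1 :=
    Runs.push' (by simp only [hσ₁]; simp [hLu])
  set σ₂ : PRF := { σ with Lu := [true], U2 := List.replicate ℓ true } with hσ₂
  have h2 : Runs (copy pEu pU2 (ra .t) (ra .u)) (base σ₁.regs) (base σ₂.regs) (10 * ℓ + 3) := by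
    have h := runs_ocopy (β := POwn) (a := .Eu) (b := .U2) (by decide) σ₁.regs
    refine h.of_eq ?_ ?_
    · simp only [hσ₂, hσ₁]; simp [hEu, hU2]
    · simp [hσ₁, hEu]
  -- the doubling loop
  let S : ℕ → Regs PReg := fun j => base { σ with Lu := List.replicate (2 ^ j) true, U2 := [] }.regs
  have hS : ∀ j, S j pU2 = [] := fun j => by simp [S]
  have hbody : ∀ j (w : List Bool), j < ℓ →
      Runs (dblUnary pLu ptk) (Function.update (S j) pU2 w) (Function.update (S (j + 1)) pU2 w)
        (7 * 2 ^ ℓ + 2) := by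
    intro j w hj
    have h := runs_dblUnary (N := pLu) (N2 := ptk) (by decide) (2 ^ j) (Function.update (S j) pU2 w)
      (by simp [S]) (by simp [S, htk])
    refine h.of_eq ?_ ?_
    · simp only [S, Nat.pow_succ']; simp
    · have : 2 ^ j ≤ 2 ^ ℓ := Nat.pow_le_pow_right two_pos hj.le
      omega
  have h3 := runs_loop_count S (7 * 2 ^ ℓ + 2) ℓ hS hbody (List.replicate ℓ true) 0 (by simp)
  have e0 : Function.update (S 0) pU2 (List.replicate ℓ true) = base σ₂.regs := by
    simp only [S, hσ₂, pow_zero, List.replicate_one]; simp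
  rw [e0, List.length_replicate, Nat.zero_add] at h3
  refine (h1.seq (h2.seq h3)).of_eq ?_ (by omega)
  simp only [S]
  congr 1
  rw [← hU2]

/-- Effect of `mkLN`. [folklore] -/
theorem runs_mkLN (ℓ : ℕ) (σ : PRF) (hEu : σ.Eu = List.replicate ℓ true) (hLN : σ.LN = [])
    (hU2 : σ.U2 = []) :
    Runs mkLN (base σ.regs) (base { σ with LN := encodeNat (2 ^ ℓ) }.regs)
      (1 + (10 * ℓ + 3) + (ℓ * (1 + 2) + 1)) := by
  set σ₁ : PRF := { σ with LN := [true] } with hσ₁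
  have h1 : Runs (push pLN true) (base σ.regs) (base σ₁.regs) 1 :=
    Runs.push' (by simp only [hσ₁]; simp [hLN])
  set σ₂ : PRF := { σ with LN := [true], U2 := List.replicate ℓ true } with hσ₂
  have h2 : Runs (copy pEu pU2 (ra .t) (ra .u)) (base σ₁.regs) (base σ₂.regs) (10 * ℓ + 3) := by
    have h := runs_ocopy (β := POwn) (a := .Eu) (b := .U2) (by decide) σ₁.regs
    refine h.of_eq ?_ ?_
    · simp only [hσ₂, hσ₁]; simp [hEu, hU2]
    · simp [hσ₁, hEu]
  let S : ℕ → Regs PReg := fun j => base { σ with LN := List.replicate j false ++ [true], U2 := [] }.regs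
  have hS : ∀ j, S j pU2 = [] := fun j => by simp [S]
  have hbody : ∀ j (w : List Bool), j < ℓ →
      Runs (push pLN false) (Function.update (S j) pU2 w) (Function.update (S (j + 1)) pU2 w) 1 := by
    intro j w _
    refine Runs.push' ?_
    simp only [S, List.replicate_succ, List.cons_append]; simp
  have h3 := runs_loop_count S 1 ℓ hS hbody (List.replicate ℓ true) 0 (by simp)
  have e0 : Function.update (S 0) pU2 (List.replicate ℓ true) = base σ₂.regs := by
    simp only [S, hσ₂, List.replicate_zero, List.nil_append]; simp
  rw [e0, List.length_replicate, Nat.zero_add] at h3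
  refine (h1.seq (h2.seq h3)).of_eq ?_ (by omega)
  simp only [S, encodeNat_two_pow]
  congr 1
  rw [← hU2]

/-- **Effect of the parameter phase.** With `q = ⌊log₂ n⌋ / r` and `ℓ = ellOf r n = 2^q - 1`:
`Eu = 1^ℓ`, `EL = bin ℓ`, `Lu = 1^{2^ℓ}`, `LN = bin 2^ℓ`, `SS = bin (s + 2)`,
`G = bin (2^ℓ (s + 2))`, `NN = bin (n - ℓ)`. [folklore] -/
theorem runs_paramsProg {r : ℕ} (hr : 0 < r) (n₀ s : ℕ) (σ : PRF) (hNN : σ.NN = encodeNat n₀)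
    (hSS : σ.SS = encodeNat s) (hX : σ.X = []) (hKu : σ.Ku = []) (hVu : σ.Vu = []) (hEL : σ.EL = [])
    (hEu : σ.Eu = []) (hLu : σ.Lu = []) (hLN : σ.LN = []) (hG : σ.G = []) (hU2 : σ.U2 = [])
    (htk : σ.tk = []) :
    Runs (paramsProg r) (base σ.regs)
      (base { σ with
        Eu := List.replicate (ellOf r n₀) true, EL := encodeNat (ellOf r n₀)
        Lu := List.replicate (2 ^ ellOf r n₀) true, LN := encodeNat (2 ^ ellOf r n₀)
        SS := encodeNat (s + 2), G := encodeNat (2 ^ ellOf r n₀ * (s + 2)), NN := encodeNat (n₀ - ellOf r n₀) }.regs)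
      (paramsCost r n₀ s (Nat.log 2 n₀ / r) (ellOf r n₀)) := by
  set q := Nat.log 2 n₀ / r with hq
  set ℓ := ellOf r n₀ with hℓ
  have hℓq : ℓ = 2 ^ q - 1 := rfl
  have hqn : q ≤ n₀ := (Nat.div_le_self _ _).trans (Nat.log_le_self 2 n₀)
  have hℓn : ℓ ≤ n₀ := ellOf_le r n₀
  -- (a) copy `NN` to `X`
  set σa : PRF := { σ with X := encodeNat n₀ } with hσa
  have ha : Runs (copy pNN pX (ra .t) (ra .u)) (base σ.regs) (base σa.regs) (10 * (encodeNat n₀).length + 3) := by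
    have h := runs_ocopy (β := POwn) (a := .NN) (b := .X) (by decide) σ.regs
    refine h.of_eq ?_ ?_
    · simp only [hσa]; simp [hNN, hX]
    · simp [hNN]
  -- (b) count its bits
  set σb : PRF := { σ with X := [], Ku := List.replicate (encodeNat n₀).length true } with hσb
  have hb : Runs (bitCount pX pKu) (base σa.regs) (base σb.regs) (3 * (encodeNat n₀).length + 1) := by
    have h := runs_bitCount (X := pX) (U := pKu) (by decide) (encodeNat n₀) (base σa.regs) (by simp [hσa])
    refine h.of_eq ?_ le_rfl
    simp only [hσb, hσa]; simp [hKu]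
  -- (c) less one: `⌊log₂ n⌋` tokens
  set σc : PRF := { σ with X := [], Ku := List.replicate (Nat.log 2 n₀) true } with hσc
  have hc : Runs (popOne pKu) (base σb.regs) (base σc.regs) 2 := by
    have h := runs_popOne pKu (encodeNat n₀).length (base σb.regs) (by simp [hσb])
    refine h.of_eq ?_ le_rfl
    simp only [hσc, hσb, length_encodeNat_sub_one]; simp
  -- (d) divide by `r`
  set σd : PRF := { σ with X := [], Ku := [], Vu := List.replicate q true } with hσd
  have hd : Runs (divProg pKu pVu r) (base σc.regs) (base σd.regs) (Nat.log 2 n₀ * (2 * r + 1) + 1) := by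
    have h := runs_divProg (U := pKu) (Q := pVu) (by decide) hr (Nat.log 2 n₀) (base σc.regs) (by simp [hσc])
    refine h.of_eq ?_ le_rfl
    simp only [hσd, hσc, hq]; simp [hVu]
  -- (e) one token on `Eu`
  set σe : PRF := { σd with Eu := [true] } with hσe
  have he : Runs (push pEu true) (base σd.regs) (base σe.regs) 1 :=
    Runs.push' (by simp only [hσe, hσd]; simp [hEu])
  -- (f) `q` doublings
  let S : ℕ → Regs PReg := fun j => base { σ with
    X := [], Ku := [], Vu := [], Eu := List.replicate (2 ^ j) true, EL := List.replicate j true }.regs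
  have hS : ∀ j, S j pVu = [] := fun j => by simp [S]
  have hbody : ∀ j (w : List Bool), j < q →
      Runs dblBody (Function.update (S j) pVu w) (Function.update (S (j + 1)) pVu w) (7 * 2 ^ q + 3) := by
    intro j w hj
    have h1 := runs_dblUnary (N := pEu) (N2 := ptk) (by decide) (2 ^ j) (Function.update (S j) pVu w)
      (by simp [S]) (by simp [S, htk])
    have h2 := Runs.push pEL true (Function.update (Function.update (S j) pVu w) pEu
      (List.replicate (2 * 2 ^ j) true))
    refine (h1.seq h2).of_eq ?_ ?_
    · simp only [S, Nat.pow_succ', List.replicate_succ]; simp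
    · have : 2 ^ j ≤ 2 ^ q := Nat.pow_le_pow_right two_pos hj.le
      omega
  have hf := runs_loop_count S (7 * 2 ^ q + 3) q hS hbody (List.replicate q true) 0 (by simp)
  have e0 : Function.update (S 0) pVu (List.replicate q true) = base σe.regs := by
    simp only [S, hσe, hσd, pow_zero, List.replicate_one, List.replicate_zero, hEL]; simp
  rw [e0, List.length_replicate, Nat.zero_add] at hf
  -- (g) less one: `ℓ` tokens
  set σg : PRF := { σ with
    X := [], Ku := [], Vu := [], Eu := List.replicate ℓ true, EL := List.replicate q true } with hσg
  have hg : Runs (popOne pEu) (S q) (base σg.regs) 2 := by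
    have h := runs_popOne pEu (2 ^ q) (S q) (by simp [S])
    refine h.of_eq ?_ le_rfl
    simp only [hσg, S, hℓq]; simp
  -- (h), (i) `2^ℓ` in unary and binary
  set σh : PRF := { σg with Lu := List.replicate (2 ^ ℓ) true } with hσh
  have hh : Runs mkLu (base σg.regs) (base σh.regs) (1 + (10 * ℓ + 3) + (ℓ * (7 * 2 ^ ℓ + 2 + 2) + 1)) :=
    runs_mkLu ℓ σg (by simp [hσg]) (by simp [hσg, hLu]) (by simp [hσg, hU2]) (by simp [hσg, htk])
  set σi : PRF := { σh with LN := encodeNat (2 ^ ℓ) } with hσi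
  have hi : Runs mkLN (base σh.regs) (base σi.regs) (1 + (10 * ℓ + 3) + (ℓ * (1 + 2) + 1)) :=
    runs_mkLN ℓ σh (by simp [hσh, hσg]) (by simp [hσh, hσg, hLN]) (by simp [hσh, hσg, hU2])
  -- (j), (k) `s + 2`
  set σj : PRF := { σi with SS := encodeNat (s + 1) } with hσj
  have hj : Runs (nSucc .SS .SS) (base σi.regs) (base σj.regs) (72 * (s + 1)) := by
    have h := runs_nSucc (β := POwn) .SS .SS σi.regs (n := s) (by simp [hσi, hσh, hσg, hSS, length_encodeNat_le_self])
      (by simp [hσi, hσh, hσg, hSS]; exact (length_encodeNat_le_self s).trans (Nat.le_succ s))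
    refine h.of_eq ?_ le_rfl
    simp only [hσj, hσi, hσh, hσg]; simp [hSS]
  set σk : PRF := { σi with SS := encodeNat (s + 2) } with hσk
  have hk : Runs (nSucc .SS .SS) (base σj.regs) (base σk.regs) (72 * (s + 2)) := by
    have h := runs_nSucc (β := POwn) .SS .SS σj.regs (n := s + 1) (by simp [hσj, length_encodeNat_le_self])
      (by simp [hσj]; exact (length_encodeNat_le_self (s + 1)).trans (Nat.le_succ _))
    refine h.of_eq ?_ le_rfl
    simp only [hσk, hσj, hσi]; simp
  -- (l) `G`
  set σl : PRF := { σk with G := encodeNat (2 ^ ℓ * (s + 2)) } with hσl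
  have hl : Runs (nMul .G .LN .SS) (base σk.regs) (base σl.regs) (270 * (ℓ + s + 3) ^ 2) := by
    have h := runs_nMul (β := POwn) .G .LN .SS σk.regs (n := ℓ + s + 2)
      (by simp [hσk, hσi, encodeNat_two_pow]; omega)
      (by simp [hσk]; exact (length_encodeNat_le_self _).trans (by omega))
      (by simp [hσk, hσi, hσh, hσg, hG])
    refine h.of_eq ?_ (le_of_eq (by ring))
    simp only [hσl, hσk, hσi]; simp
  -- (m) `n - ℓ`
  set σm : PRF := { σl with NN := encodeNat (n₀ - ℓ) } with hσm
  have hm : Runs (nSub .NN .NN .EL) (base σl.regs) (base σm.regs) (71 * (n₀ + 1)) := by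
    have h := runs_nSub (β := POwn) .NN .NN .EL σl.regs (n := n₀)
      (by simp [hσl, hσk, hσi, hσh, hσg, hNN, length_encodeNat_le_self])
      (by simp [hσl, hσk, hσi, hσh, hσg]; exact hqn)
      (by simp [hσl, hσk, hσi, hσh, hσg, hNN]; exact (length_encodeNat_le_self _).trans (Nat.le_succ _))
      (by simp [hσl, hσk, hσi, hσh, hσg, hNN, bitsToNat_replicate_true, ← hℓq, hℓn])
    refine h.of_eq ?_ le_rfl
    simp only [hσm, hσl, hσk, hσi, hσh, hσg]; simp [hNN, bitsToNat_replicate_true, ← hℓq]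
  have H := (ha.seq (hb.seq (hc.seq hd))).seq ((he.seq (hf.seq hg)).seq (hh.seq (hi.seq
    (hj.seq (hk.seq (hl.seq hm))))))
  refine H.of_eq ?_ ?_
  · simp only [hσm, hσl, hσk, hσi, hσh, hσg, hℓq, encodeNat_two_pow_sub_one]
    rw [hX, hKu, hVu]
  · unfold paramsCost; omega


/-! ### Phase 2: emitting the header of the output -/

/-- `emitHeaderProg`: emit `bin (n - ℓ)`, `bin 1` (the output of `C'` is a gate), `bin G` (its
index) and `bin (G + 1)` (the size of `C'`), counting four items. [folklore] -/
def emitHeaderProg : Com PReg :=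
  emitReg pNN po pcnt ;; ((setConst pX [true] ;; emitReg pX po pcnt) ;;
    ((copy pG pX (ra .t) (ra .u) ;; emitReg pX po pcnt) ;; (nSucc .G .G ;; emitReg pG po pcnt)))

/-- The cost of Phase 2. [folklore] -/
def emitHeaderCost (N G : ℕ) : ℕ :=
  (4 * (encodeNat N).length + 4) + (2 + 8) +
    ((10 * (encodeNat G).length + 3) + (4 * (encodeNat G).length + 4)) +
    (72 * (G + 1) + (4 * (encodeNat (G + 1)).length + 4))

/-- **Effect of Phase 2**: the four header items are appended to the reversed output and
counted; `NN` and `G` are consumed. [folklore] -/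
theorem runs_emitHeaderProg (E : List (List Bool)) (N G : ℕ) (σ : PRF) (ho : σ.o = outRev E)
    (hNN : σ.NN = encodeNat N) (hG : σ.G = encodeNat G) (hX : σ.X = []) :
    Runs emitHeaderProg (base σ.regs)
      (base { σ with
        o := outRev (E ++ [encodeNat N, encodeNat 1, encodeNat G, encodeNat (G + 1)])
        cnt := true :: true :: true :: true :: σ.cnt, NN := [], G := [] }.regs)
      (emitHeaderCost N G) := by
  -- `n - ℓ`
  set σ₁ : PRF := { σ with o := outRev (E ++ [encodeNat N]), cnt := true :: σ.cnt, NN := [] } with hσ₁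
  have h1 : Runs (emitReg pNN po pcnt) (base σ.regs) (base σ₁.regs) (4 * (encodeNat N).length + 4) := by
    have h := runs_emitReg (X := pNN) (o := po) (cnt := pcnt) (by decide) (by decide) (by decide) E
      (encodeNat N) (base σ.regs) (by simp [hNN]) (by simp [ho])
    refine h.of_eq ?_ le_rfl
    simp only [hσ₁]; simp
  -- `1`
  set σ₂ : PRF := { σ₁ with X := [true] } with hσ₂
  have h2 : Runs (setConst pX [true]) (base σ₁.regs) (base σ₂.regs) 2 := by
    have h := runs_setConst pX [true] (base σ₁.regs)
    refine h.of_eq ?_ ?_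
    · simp only [hσ₂, hσ₁]; simp
    · simp [hσ₁, hX]
  set σ₃ : PRF := { σ with
    o := outRev (E ++ [encodeNat N, encodeNat 1]), cnt := true :: true :: σ.cnt, NN := [], X := [] } with hσ₃
  have h3 : Runs (emitReg pX po pcnt) (base σ₂.regs) (base σ₃.regs) (4 * 1 + 4) := by
    have h := runs_emitReg (X := pX) (o := po) (cnt := pcnt) (by decide) (by decide) (by decide)
      (E ++ [encodeNat N]) [true] (base σ₂.regs) (by simp [hσ₂]) (by simp [hσ₂, hσ₁])
    refine h.of_eq ?_ le_rfl
    simp only [hσ₃, hσ₂, hσ₁, List.append_assoc, List.singleton_append, encodeNat_one]; simp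
  -- `G`
  set σ₄ : PRF := { σ₃ with X := encodeNat G } with hσ₄
  have h4 : Runs (copy pG pX (ra .t) (ra .u)) (base σ₃.regs) (base σ₄.regs) (10 * (encodeNat G).length + 3) := by
    have h := runs_ocopy (β := POwn) (a := .G) (b := .X) (by decide) σ₃.regs
    refine h.of_eq ?_ ?_
    · simp only [hσ₄, hσ₃]; simp [hG]
    · simp [hσ₃, hG]
  set σ₅ : PRF := { σ with
    o := outRev (E ++ [encodeNat N, encodeNat 1, encodeNat G]), cnt := true :: true :: true :: σ.cnt
    NN := [], X := [] } with hσ₅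
  have h5 : Runs (emitReg pX po pcnt) (base σ₄.regs) (base σ₅.regs) (4 * (encodeNat G).length + 4) := by
    have h := runs_emitReg (X := pX) (o := po) (cnt := pcnt) (by decide) (by decide) (by decide)
      (E ++ [encodeNat N, encodeNat 1]) (encodeNat G) (base σ₄.regs) (by simp [hσ₄]) (by simp [hσ₄, hσ₃])
    refine h.of_eq ?_ le_rfl
    simp only [hσ₅, hσ₄, hσ₃, List.append_assoc, List.cons_append, List.nil_append]; simp
  -- `G + 1`
  set σ₆ : PRF := { σ₅ with G := encodeNat (G + 1) } with hσ₆
  have h6 : Runs (nSucc .G .G) (base σ₅.regs) (base σ₆.regs) (72 * (G + 1)) := by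
    have h := runs_nSucc (β := POwn) .G .G σ₅.regs (n := G) (by simp [hσ₅, hG, length_encodeNat_le_self])
      (by simp [hσ₅, hG]; exact (length_encodeNat_le_self G).trans (Nat.le_succ G))
    refine h.of_eq ?_ le_rfl
    simp only [hσ₆, hσ₅]; simp [hG]
  set σ₇ : PRF := { σ with
    o := outRev (E ++ [encodeNat N, encodeNat 1, encodeNat G, encodeNat (G + 1)])
    cnt := true :: true :: true :: true :: σ.cnt, NN := [], X := [], G := [] } with hσ₇
  have h7 : Runs (emitReg pG po pcnt) (base σ₆.regs) (base σ₇.regs) (4 * (encodeNat (G + 1)).length + 4) := by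
    have h := runs_emitReg (X := pG) (o := po) (cnt := pcnt) (by decide) (by decide) (by decide)
      (E ++ [encodeNat N, encodeNat 1, encodeNat G]) (encodeNat (G + 1)) (base σ₆.regs) (by simp [hσ₆])
      (by simp [hσ₆, hσ₅])
    refine h.of_eq ?_ le_rfl
    simp only [hσ₇, hσ₆, hσ₅, List.append_assoc, List.cons_append, List.nil_append]; simp
  refine (h1.seq ((h2.seq h3).seq ((h4.seq h5).seq (h6.seq h7)))).of_eq ?_ ?_
  · simp only [hσ₇]; rw [hX]
  · unfold emitHeaderCost; omega

end PreprocP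

end Literature.Computability.Complexity
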